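import Summits.Parity.BatemanHorn.Theses.IsogenyRedei
import Summits.Parity.BatemanHorn.Theorems.IsogenyRedeiOmegaToMobiusAPCounting
import Summits.Parity.BatemanHorn.Theorems.IsogenyRedeiOmegaToMobiusAPSieve
import Summits.Parity.BatemanHorn.Theorems.IsogenyRedeiQuadraticOmegaParityLiouvilleAPToOmegaLemmas
import Literature.NumberTheory.Sieve.PolynomialCongruencesRootCount

/-!
# Junction `LiouvilleAP → QuadraticOmegaParity` (crux stmt-Parity-11585, line `Sketch`)

If for every irreducible quadratic `f ∈ ℤ[X]` with positive leading coefficient and every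
progression `n ≡ a (q)` one has `Σ_{n ≤ x, n ≡ a (q)} λ(f(n)) = o(x)` (Liouville parity,
`λ = (−1)^Ω`, Mathlib's `ArithmeticFunction.liouville`, values `f(n) ≤ 0` through `toNat`), then the
same holds with `(−1)^{ω(f(n))}` — the crux `QuadraticOmegaParity` of route `IsogenyRedei`.  This
is the mirror image of the tree's `omegaToMobiusAP_proof` (ω-parity ⇒ μ), and pins the crux to
Chowla's conjecture for integer quadratics in both currencies.

Proof: the valuation-truncated squarefree sieve.  For `m ≠ 0`,
`(−1)^{ω(m)} = λ(m) · ∏_{p ∣ m} (−1)^{v_p(m)+1}`.  Fix a level `L` and a cut-off `K` and put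
`M = q · (L!)^K`.  Discard from `[1, x]`: the `n < N₀` (where `f(n) ≤ 0` is possible); the `n` with
`p² ∣ f(n)` for a prime `p > L` (at most `2x/L + 2π(Bx)` of them, by the local count modulo `p²` of
`IsogenyRedeiOmegaToMobiusAPCounting`, valid once `L ≥ R₀(f)`); and the `n` with `p^K ∣ f(n)` for
a prime `p ≤ L` (a union of `ρ_f(p^K) ≤ W` residue classes modulo `p^K ∣ M`, hence at most
`W (L+1) (x/2^K + 1)` of them, `W = W(f)` from the Nagell–Hensel bound
`Literature.NumberTheory.Sieve.exists_polyRootCountMod_prime_pow_le`).  For the remaining `n` the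
factor `∏_{p ∣ f(n)} (−1)^{v_p+1}` only sees the primes `p ≤ L`, with `v_p(f(n)) = v_p(f(c)) < K`
determined by `c = n mod M`; so the surviving sum is a finite combination, over classes `c mod M`,
of the hypothesis' sums `Σ_{n ≤ x, n ≡ c (M)} λ(f(n)) = o(x)`.  Each discarded term costs at most
`2`, whence `limsup |S(x)|/x ≤ 4/L + 2W(L+1)/2^K`; with `K = W(L+1)L` this is `≤ 5/L`, and
`L → ∞` (run as `L = 3R` inside `isLittleO_of_forall_approx`).
The pointwise lemmas are in `IsogenyRedeiQuadraticOmegaParityLiouvilleAPToOmegaLemmas`; here the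
summed core estimate and the deciding theorem `liouvilleAP_to_quadraticOmegaParity` (registered
alias `stub_liouvilleAP_to_omega`).
-/

open Filter Finset Asymptotics Polynomial

namespace Summit.Parity.BatemanHorn.Theorems.LiouvilleAPToOmega

open Summit.Parity.BatemanHorn.Theorems.OmegaToMobiusAP

/-- **Core estimate** of the valuation-truncated squarefree sieve: for a level `L ≥ 1` beyond the
bad primes of `f` and any cut-off `K`, there are weights `w` on the residues modulo
`M = q (L!)^K` with
`|Σ_{n ≤ x, n ≡ a (q)} (−1)^{ω(f(n))} − Σ_{c < M} w(c) Σ_{n ≤ x, n ≡ c (M)} λ(f(n))|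
  ≤ 2N₀ + W(L+1)(x/2^K + 1) + 4x/L + 4π(Bx)`. [folklore] -/
theorem core_estimate (f : ℤ[X]) (hf : f.natDegree = 2)
    (N₀ : ℕ) (hN₀ : ∀ n : ℕ, N₀ ≤ n → 0 < f.eval (n : ℤ))
    (Bh : ℕ) (hBh1 : 1 ≤ Bh)
    (hBh : ∀ n x : ℕ, 1 ≤ n → n ≤ x → f.eval (n : ℤ) ≤ (Bh : ℤ) * (x : ℤ) ^ 2)
    (W : ℕ) (hW : ∀ p : ℕ, p.Prime → ∀ k : ℕ,
      ((Finset.range (p ^ k)).filter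
        (fun ν : ℕ => ((p ^ k : ℕ) : ℤ) ∣ f.eval (ν : ℤ))).card ≤ W)
    (L K : ℕ) (hL : 0 < L)
    (hgood : ∀ p : ℕ, p.Prime → L < p →
      ¬ (p : ℤ) ∣ 2 * f.coeff 2 * (f.coeff 1 ^ 2 - 4 * f.coeff 2 * f.coeff 0))
    (q a : ℕ) (hq : 0 < q) :
    ∃ w : ℕ → ℝ, ∀ x : ℕ,
      |∑ n ∈ (Finset.Icc 1 x).filter (fun n : ℕ => n ≡ a [MOD q]),
            (-1 : ℝ) ^ ArithmeticFunction.cardDistinctFactors ((f.eval (n : ℤ)).toNat)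
        - ∑ c ∈ Finset.range (q * Nat.factorial L ^ K), w c *
            ∑ n ∈ (Finset.Icc 1 x).filter
              (fun n : ℕ => n ≡ c [MOD q * Nat.factorial L ^ K]),
              (ArithmeticFunction.liouville ((f.eval (n : ℤ)).toNat) : ℝ)|
        ≤ 2 * N₀ + W * (L + 1) * ((x : ℝ) / 2 ^ K + 1) + 4 * x / L
          + 4 * (Nat.primesLE (Bh * x)).card := by
  classical
  set M := q * Nat.factorial L ^ K with hM
  have hMpos : 0 < M := Nat.mul_pos hq (pow_pos (Nat.factorial_pos L) K)
  have hqM : q ∣ M := Dvd.intro _ rfl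
  set P : ℕ → Prop := fun c => ∀ p ∈ Nat.primesLE L, ¬ ((p : ℤ) ^ K ∣ f.eval (c : ℤ)) with hP
  set θ : ℕ → ℝ := fun c => (-1 : ℝ) ^ (∑ p ∈ (Nat.primesLE L).filter
      (fun p : ℕ => (p : ℤ) ∣ f.eval (c : ℤ)), (padicValInt p (f.eval (c : ℤ)) + 1)) with hθ
  refine ⟨fun c => if c ≡ a [MOD q] ∧ P c then θ c else 0, fun x => ?_⟩
  beta_reduce
  set A := (Finset.Icc 1 x).filter (fun n : ℕ => n ≡ a [MOD q]) with hA
  set s : ℕ → ℝ := fun n =>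
    (-1 : ℝ) ^ ArithmeticFunction.cardDistinctFactors ((f.eval (n : ℤ)).toNat) with hs
  set lam : ℕ → ℝ := fun n => (ArithmeticFunction.liouville ((f.eval (n : ℤ)).toNat) : ℝ)
    with hlam
  set χ : ℕ → ℝ := fun n => if P (n % M) then 1 else 0 with hχ
  set PR := (Nat.primesLE (Bh * x)).filter (fun p => L < p) with hPR
  -- Step 1: the main term is `Σ_{n ∈ A} θ (n % M) * χ n * lam n`
  have hmain : ∑ c ∈ Finset.range M, (if c ≡ a [MOD q] ∧ P c then θ c else 0) *
        ∑ n ∈ (Finset.Icc 1 x).filter (fun n : ℕ => n ≡ c [MOD M]), lam n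
      = ∑ n ∈ A, θ (n % M) * χ n * lam n := by
    calc ∑ c ∈ Finset.range M, (if c ≡ a [MOD q] ∧ P c then θ c else 0) *
          ∑ n ∈ (Finset.Icc 1 x).filter (fun n : ℕ => n ≡ c [MOD M]), lam n
        = ∑ c ∈ (Finset.range M).filter (fun c : ℕ => c ≡ a [MOD q] ∧ P c),
            θ c * ∑ n ∈ (Finset.Icc 1 x).filter (fun n : ℕ => n ≡ c [MOD M]), lam n := by
          rw [Finset.sum_filter]
          refine Finset.sum_congr rfl (fun c _ => ?_)
          split_ifs <;> simp
      _ = ∑ c ∈ (Finset.range M).filter (fun c : ℕ => c ≡ a [MOD q] ∧ P c),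
            ∑ n ∈ (Finset.Icc 1 x).filter (fun n : ℕ => n ≡ c [MOD M]),
              θ (n % M) * lam n := by
          refine Finset.sum_congr rfl (fun c hc => ?_)
          rw [Finset.mul_sum]
          refine Finset.sum_congr rfl (fun n hn => ?_)
          have hcM : c < M := Finset.mem_range.mp (Finset.mem_filter.mp hc).1
          have hnc : n % M = c := by
            have h1 : n ≡ c [MOD M] := (Finset.mem_filter.mp hn).2
            unfold Nat.ModEq at h1
            rw [h1, Nat.mod_eq_of_lt hcM]
          rw [hnc]
      _ = ∑ n ∈ (Finset.Icc 1 x).filter (fun n : ℕ => n ≡ a [MOD q] ∧ P (n % M)),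
            θ (n % M) * lam n :=
          (sum_filter_modEq_regroup (fun n => θ (n % M) * lam n) P hMpos hqM a x).symm
      _ = ∑ n ∈ A, θ (n % M) * χ n * lam n := by
          rw [hA, ← Finset.filter_filter, Finset.sum_filter]
          refine Finset.sum_congr rfl (fun n _ => ?_)
          simp only [hχ]
          split_ifs <;> simp
  -- Step 2: pointwise error
  have herr : ∀ n ∈ A, |s n - θ (n % M) * χ n * lam n|
      ≤ 2 * (if n < N₀ then (1 : ℝ) else 0)
        + (∑ p ∈ Nat.primesLE L, if (p : ℤ) ^ K ∣ f.eval (n : ℤ) then (1 : ℝ) else 0)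
        + 2 * ∑ p ∈ PR, (if (p : ℤ) ^ 2 ∣ f.eval (n : ℤ) then (1 : ℝ) else 0) := by
    intro n hn
    have hn' : n ∈ Finset.Icc 1 x := (Finset.mem_filter.mp hn).1
    exact abs_pointwise_error_le f N₀ hN₀ Bh hBh1 hBh q L K hn'
  have hAsub : A ⊆ Finset.Icc 1 x := Finset.filter_subset _ _
  -- Step 3: the three summed pieces
  have hpiece1 : ∑ n ∈ Finset.Icc 1 x, (2 * (if n < N₀ then (1 : ℝ) else 0)) ≤ 2 * N₀ := by
    rw [← Finset.mul_sum, ← Finset.sum_filter, Finset.sum_const, nsmul_eq_mul, mul_one]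
    have hc : ((Finset.Icc 1 x).filter (fun n => n < N₀)).card ≤ N₀ := by
      calc ((Finset.Icc 1 x).filter (fun n => n < N₀)).card ≤ (Finset.range N₀).card :=
            Finset.card_le_card (fun n hn => by
              rw [Finset.mem_filter] at hn
              exact Finset.mem_range.mpr hn.2)
        _ = N₀ := Finset.card_range _
    have hc' : (((Finset.Icc 1 x).filter (fun n => n < N₀)).card : ℝ) ≤ N₀ := by exact_mod_cast hc
    linarith
  have hpiece2 : ∑ n ∈ Finset.Icc 1 x, ∑ p ∈ Nat.primesLE L,
      (if (p : ℤ) ^ K ∣ f.eval (n : ℤ) then (1 : ℝ) else 0)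
        ≤ W * (L + 1) * ((x : ℝ) / 2 ^ K + 1) := by
    rw [Finset.sum_comm]
    have hcardL : ((Nat.primesLE L).card : ℝ) ≤ L + 1 := by
      have h1 : (Nat.primesLE L).card ≤ L + 1 := by
        calc (Nat.primesLE L).card ≤ (Finset.range (L + 1)).card :=
              Finset.card_le_card (Finset.filter_subset _ _)
          _ = L + 1 := Finset.card_range _
      exact_mod_cast h1
    have hterm : ∀ p ∈ Nat.primesLE L, ∑ n ∈ Finset.Icc 1 x,
        (if (p : ℤ) ^ K ∣ f.eval (n : ℤ) then (1 : ℝ) else 0) ≤ W * ((x : ℝ) / 2 ^ K + 1) := by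
      intro p hp
      have hpp := Nat.prime_of_mem_primesLE hp
      rw [Finset.sum_boole]
      have hpk : 0 < p ^ K := pow_pos hpp.pos K
      have e : ∀ n : ℕ, ((p : ℤ) ^ K ∣ f.eval (n : ℤ)) ↔ (((p ^ K : ℕ) : ℤ) ∣ f.eval (n : ℤ)) :=
        fun n => by push_cast; exact Iff.rfl
      rw [Finset.filter_congr (fun n _ => e n)]
      have h3 : ((Finset.Icc 1 x).filter
          (fun n : ℕ => ((p ^ K : ℕ) : ℤ) ∣ f.eval (n : ℤ))).card ≤ W * (x / p ^ K + 1) :=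
        (card_filter_Icc_dvd_eval_le f hpk x).trans (Nat.mul_le_mul_right _ (hW p hpp K))
      have h4 : (((Finset.Icc 1 x).filter
          (fun n : ℕ => ((p ^ K : ℕ) : ℤ) ∣ f.eval (n : ℤ))).card : ℝ)
            ≤ W * ((x / p ^ K : ℕ) + 1 : ℝ) := by exact_mod_cast h3
      have h5 : ((x / p ^ K : ℕ) : ℝ) ≤ (x : ℝ) / 2 ^ K := by
        calc ((x / p ^ K : ℕ) : ℝ) ≤ (x : ℝ) / ((p ^ K : ℕ) : ℝ) := Nat.cast_div_le
          _ ≤ (x : ℝ) / 2 ^ K := by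
            apply div_le_div_of_nonneg_left (Nat.cast_nonneg x) (by positivity)
            push_cast
            exact pow_le_pow_left₀ (by norm_num) (by exact_mod_cast hpp.two_le) K
      calc _ ≤ W * ((x / p ^ K : ℕ) + 1 : ℝ) := h4
        _ ≤ W * ((x : ℝ) / 2 ^ K + 1) := by gcongr
    calc ∑ p ∈ Nat.primesLE L, ∑ n ∈ Finset.Icc 1 x,
          (if (p : ℤ) ^ K ∣ f.eval (n : ℤ) then (1 : ℝ) else 0)
        ≤ ∑ p ∈ Nat.primesLE L, (W * ((x : ℝ) / 2 ^ K + 1)) := Finset.sum_le_sum hterm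
      _ = (Nat.primesLE L).card * (W * ((x : ℝ) / 2 ^ K + 1)) := by
          rw [Finset.sum_const, nsmul_eq_mul]
      _ ≤ (L + 1) * (W * ((x : ℝ) / 2 ^ K + 1)) := by gcongr
      _ = W * (L + 1) * ((x : ℝ) / 2 ^ K + 1) := by ring
  have hpiece3 : ∑ n ∈ Finset.Icc 1 x, ∑ p ∈ PR,
      (if (p : ℤ) ^ 2 ∣ f.eval (n : ℤ) then (1 : ℝ) else 0)
        ≤ 2 * x / L + 2 * (Nat.primesLE (Bh * x)).card := by
    rw [Finset.sum_comm]
    refine le_trans (Finset.sum_le_sum (fun p hp => ?_)) (sum_local_bounds_le L Bh x hL)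
    rw [← Finset.sum_filter, Finset.sum_const, nsmul_eq_mul, mul_one]
    have hpp : p.Prime := (Nat.mem_primesLE.mp (Finset.mem_filter.mp hp).1).2
    have hLp : L < p := (Finset.mem_filter.mp hp).2
    have hcard := card_roots_Icc_le hpp (hgood p hpp hLp) x
    have heq : (Finset.Icc 1 x).filter (fun n : ℕ => (p : ℤ) ^ 2 ∣ f.eval (n : ℤ))
        = (Finset.Icc 1 x).filter
            (fun n : ℕ => (p : ℤ) ^ 2 ∣ f.coeff 2 * n ^ 2 + f.coeff 1 * n + f.coeff 0) := by
      refine Finset.filter_congr (fun n _ => ?_)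
      rw [Literature.NumberTheory.Sieve.eval_eq_of_natDegree_eq_two hf]
    rw [heq]
    exact_mod_cast hcard
  -- Step 4: assemble
  have hdiff : ∑ n ∈ A, s n
      - ∑ c ∈ Finset.range M, (if c ≡ a [MOD q] ∧ P c then θ c else 0) *
          ∑ n ∈ (Finset.Icc 1 x).filter (fun n : ℕ => n ≡ c [MOD M]), lam n
      = ∑ n ∈ A, (s n - θ (n % M) * χ n * lam n) := by
    rw [hmain, Finset.sum_sub_distrib]
  rw [hdiff]
  calc |∑ n ∈ A, (s n - θ (n % M) * χ n * lam n)|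
      ≤ ∑ n ∈ A, |s n - θ (n % M) * χ n * lam n| := Finset.abs_sum_le_sum_abs _ _
    _ ≤ ∑ n ∈ A, (2 * (if n < N₀ then (1 : ℝ) else 0)
          + (∑ p ∈ Nat.primesLE L, if (p : ℤ) ^ K ∣ f.eval (n : ℤ) then (1 : ℝ) else 0)
          + 2 * ∑ p ∈ PR, (if (p : ℤ) ^ 2 ∣ f.eval (n : ℤ) then (1 : ℝ) else 0)) :=
        Finset.sum_le_sum herr
    _ ≤ ∑ n ∈ Finset.Icc 1 x, (2 * (if n < N₀ then (1 : ℝ) else 0)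
          + (∑ p ∈ Nat.primesLE L, if (p : ℤ) ^ K ∣ f.eval (n : ℤ) then (1 : ℝ) else 0)
          + 2 * ∑ p ∈ PR, (if (p : ℤ) ^ 2 ∣ f.eval (n : ℤ) then (1 : ℝ) else 0)) := by
        refine Finset.sum_le_sum_of_subset_of_nonneg hAsub (fun n _ _ => ?_)
        refine add_nonneg (add_nonneg (by split_ifs <;> norm_num)
          (Finset.sum_nonneg (fun p _ => ?_)))
          (mul_nonneg (by norm_num) (Finset.sum_nonneg (fun p _ => ?_))) <;>
        split_ifs <;> norm_num
    _ = ∑ n ∈ Finset.Icc 1 x, (2 * (if n < N₀ then (1 : ℝ) else 0))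
          + ∑ n ∈ Finset.Icc 1 x,
              (∑ p ∈ Nat.primesLE L, if (p : ℤ) ^ K ∣ f.eval (n : ℤ) then (1 : ℝ) else 0)
          + 2 * ∑ n ∈ Finset.Icc 1 x,
              ∑ p ∈ PR, (if (p : ℤ) ^ 2 ∣ f.eval (n : ℤ) then (1 : ℝ) else 0) := by
        rw [Finset.sum_add_distrib, Finset.sum_add_distrib]
        simp only [Finset.mul_sum]
    _ ≤ 2 * N₀ + W * (L + 1) * ((x : ℝ) / 2 ^ K + 1)
          + 2 * (2 * x / L + 2 * (Nat.primesLE (Bh * x)).card) := by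
        gcongr
    _ = 2 * N₀ + W * (L + 1) * ((x : ℝ) / 2 ^ K + 1) + 4 * x / L
          + 4 * (Nat.primesLE (Bh * x)).card := by ring

end Summit.Parity.BatemanHorn.Theorems.LiouvilleAPToOmega

namespace Summit.Parity.BatemanHorn.Theorems

open Summit.Parity.BatemanHorn.Theses.IsogenyRedei
open Summit.Parity.BatemanHorn.Theorems.OmegaToMobiusAP
open Summit.Parity.BatemanHorn.Theorems.LiouvilleAPToOmega

/-- **Junction 2 of line `Sketch` (crux stmt-Parity-11585).** Liouville parity of the values of
every irreducible integer quadratic along every arithmetic progression implies ω-parity along every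
arithmetic progression, i.e. `QuadraticOmegaParity`, by the valuation-truncated squarefree sieve.
[folklore] -/
theorem liouvilleAP_to_quadraticOmegaParity :
    (∀ f : ℤ[X], Irreducible f → f.natDegree = 2 → 0 < f.leadingCoeff → ∀ q a : ℕ, 0 < q →
      (fun x : ℕ => ∑ n ∈ (Finset.Icc 1 x).filter (fun n : ℕ => n ≡ a [MOD q]),
        (ArithmeticFunction.liouville ((f.eval (n : ℤ)).toNat) : ℝ)) =o[atTop]
          fun x : ℕ => (x : ℝ)) →
    QuadraticOmegaParity := by
  intro H f hirr hf hlc q a hq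
  -- the constants attached to `f = A X² + B X + C`
  set A := f.coeff 2 with hAdef
  set B := f.coeff 1 with hBdef
  set C := f.coeff 0 with hCdef
  have hA : 0 < A := by
    have h : f.leadingCoeff = A := by rw [Polynomial.leadingCoeff, hf]
    rw [← h]
    exact hlc
  have hD : B ^ 2 - 4 * A * C ≠ 0 := by
    have h := Literature.NumberTheory.Sieve.discrim_ne_zero_of_irreducible hf hirr
    unfold discrim at h
    exact h
  set N₀ : ℕ := B.natAbs + C.natAbs + 1 with hN₀def
  set Bh : ℕ := A.natAbs + B.natAbs + C.natAbs with hBhdef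
  set R₀ : ℕ := (2 * A * (B ^ 2 - 4 * A * C)).natAbs + 1 with hR₀def
  have hN₀ : ∀ n : ℕ, N₀ ≤ n → 0 < f.eval (n : ℤ) := by
    intro n hn
    rw [Literature.NumberTheory.Sieve.eval_eq_of_natDegree_eq_two hf]
    apply quadratic_pos hA
    have h1 : ((N₀ : ℕ) : ℤ) ≤ n := by exact_mod_cast hn
    have h2 : ((N₀ : ℕ) : ℤ) = |B| + |C| + 1 := by simp [hN₀def]
    linarith
  have hBh1 : 1 ≤ Bh := by
    have : 0 < A.natAbs := Int.natAbs_pos.mpr hA.ne'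
    omega
  have hBh : ∀ n x : ℕ, 1 ≤ n → n ≤ x → f.eval (n : ℤ) ≤ (Bh : ℤ) * (x : ℤ) ^ 2 := by
    intro n x h1 h2
    rw [Literature.NumberTheory.Sieve.eval_eq_of_natDegree_eq_two hf]
    have h := quadratic_le hA (B := B) (C := C) (n := (n : ℤ)) (x := (x : ℤ))
      (by exact_mod_cast h1) (by exact_mod_cast h2)
    have e : ((Bh : ℕ) : ℤ) = A + |B| + |C| := by
      simp [hBhdef, abs_of_pos hA]
    rw [e]
    exact h
  have hgood : ∀ R : ℕ, R₀ ≤ R → ∀ p : ℕ, p.Prime → R < p →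
      ¬ (p : ℤ) ∣ 2 * A * (B ^ 2 - 4 * A * C) := by
    intro R hR p hp hRp hdvd
    have hne : 2 * A * (B ^ 2 - 4 * A * C) ≠ 0 := mul_ne_zero (mul_ne_zero two_ne_zero hA.ne') hD
    have hle : p ≤ (2 * A * (B ^ 2 - 4 * A * C)).natAbs := by
      have h1 : (p : ℤ).natAbs ∣ (2 * A * (B ^ 2 - 4 * A * C)).natAbs :=
        Int.natAbs_dvd_natAbs.mpr hdvd
      rw [Int.natAbs_natCast] at h1
      exact Nat.le_of_dvd (Int.natAbs_pos.mpr hne) h1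
    omega
  -- the Nagell–Hensel constant `W`: `ρ_f(p^k) ≤ W` for every prime `p` and every `k`
  obtain ⟨Mf, -, hMf⟩ :=
    Literature.NumberTheory.Sieve.exists_polyRootCountMod_prime_pow_le hirr (by rw [hf]; norm_num)
  set W : ℕ := 2 * Mf with hWdef
  have hW : ∀ p : ℕ, p.Prime → ∀ k : ℕ,
      ((Finset.range (p ^ k)).filter
        (fun ν : ℕ => ((p ^ k : ℕ) : ℤ) ∣ f.eval (ν : ℤ))).card ≤ W := by
    intro p hp k
    rw [Literature.NumberTheory.Sieve.card_filter_dvd_eval_eq_polyRootCountMod, hWdef, ← hf]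
    exact hMf p hp k
  -- `π(B·x) = o(x)`
  have htend : Tendsto (fun x : ℕ => Bh * x) atTop atTop :=
    Filter.tendsto_atTop_mono (fun x => Nat.le_mul_of_pos_left x hBh1) tendsto_id
  have hπ : (fun x : ℕ => ((Nat.primesLE (Bh * x)).card : ℝ)) =o[atTop] (fun x : ℕ => (x : ℝ)) := by
    have h1 := isLittleO_card_primesLE.comp_tendsto htend
    have h2 : ((fun N : ℕ => (N : ℝ)) ∘ (fun x : ℕ => Bh * x)) =O[atTop]
        (fun x : ℕ => (x : ℝ)) := by
      refine Asymptotics.IsBigO.of_bound (Bh : ℝ) (Eventually.of_forall (fun x => ?_))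
      simp only [Function.comp_apply, Nat.cast_mul, norm_mul, Real.norm_natCast, le_refl]
    exact h1.trans_isBigO h2
  -- the core estimate at every level `L`, with cut-off `K = W (L+1) L`
  have hex : ∀ L : ℕ, ∃ w : ℕ → ℝ, R₀ ≤ L → 0 < L → ∀ x : ℕ,
      |∑ n ∈ (Finset.Icc 1 x).filter (fun n : ℕ => n ≡ a [MOD q]),
            (-1 : ℝ) ^ ArithmeticFunction.cardDistinctFactors ((f.eval (n : ℤ)).toNat)
        - ∑ c ∈ Finset.range (q * Nat.factorial L ^ (W * (L + 1) * L)), w c *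
            ∑ n ∈ (Finset.Icc 1 x).filter
              (fun n : ℕ => n ≡ c [MOD q * Nat.factorial L ^ (W * (L + 1) * L)]),
              (ArithmeticFunction.liouville ((f.eval (n : ℤ)).toNat) : ℝ)|
        ≤ 2 * N₀ + W * (L + 1) * ((x : ℝ) / 2 ^ (W * (L + 1) * L) + 1) + 4 * x / L
          + 4 * (Nat.primesLE (Bh * x)).card := by
    intro L
    by_cases hL : R₀ ≤ L ∧ 0 < L
    · obtain ⟨w, hw⟩ := core_estimate f hf N₀ hN₀ Bh hBh1 hBh W hW L (W * (L + 1) * L) hL.2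
        (hgood L hL.1) q a hq
      exact ⟨w, fun _ _ => hw⟩
    · exact ⟨fun _ => 0, fun h1 h2 => absurd ⟨h1, h2⟩ hL⟩
  choose w hw using hex
  -- `L = 3R`, so that the residual `5x/L` is at most `2x/R`
  refine isLittleO_of_forall_approx R₀
    (fun R x => |∑ c ∈ Finset.range (q * Nat.factorial (3 * R) ^ (W * (3 * R + 1) * (3 * R))),
          w (3 * R) c * ∑ n ∈ (Finset.Icc 1 x).filter (fun n : ℕ =>
              n ≡ c [MOD q * Nat.factorial (3 * R) ^ (W * (3 * R + 1) * (3 * R))]),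
            (ArithmeticFunction.liouville ((f.eval (n : ℤ)).toNat) : ℝ)|
        + (2 * N₀ + W * (((3 * R : ℕ) : ℝ) + 1) + 4 * ((Nat.primesLE (Bh * x)).card : ℝ))) ?_ ?_
  · -- each `G_R` is `o(x)`: finitely many hypothesis sums, a constant, and `4π(Bx)`
    intro R hR
    set L := 3 * R with hLdef
    have hMpos : 0 < q * Nat.factorial L ^ (W * (L + 1) * L) :=
      Nat.mul_pos hq (pow_pos (Nat.factorial_pos L) _)
    have hF : (fun x : ℕ => ∑ c ∈ Finset.range (q * Nat.factorial L ^ (W * (L + 1) * L)), w L c *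
            ∑ n ∈ (Finset.Icc 1 x).filter
              (fun n : ℕ => n ≡ c [MOD q * Nat.factorial L ^ (W * (L + 1) * L)]),
              (ArithmeticFunction.liouville ((f.eval (n : ℤ)).toNat) : ℝ))
        =o[atTop] (fun x : ℕ => (x : ℝ)) :=
      IsLittleO.sum (fun c _ => (H f hirr hf hlc _ c hMpos).const_mul_left (w L c))
    have hconst : (fun _ : ℕ => (2 * N₀ + W * ((L : ℝ) + 1) : ℝ)) =o[atTop]
        (fun x : ℕ => (x : ℝ)) := by
      refine Asymptotics.isLittleO_const_left.mpr (Or.inr ?_)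
      refine (tendsto_natCast_atTop_atTop (R := ℝ)).congr (fun x => ?_)
      simp only [Function.comp_apply, Real.norm_natCast]
    exact (isLittleO_abs_left.mpr hF).add (hconst.add (hπ.const_mul_left 4))
  · -- the core estimate at level `L = 3R`, with `W (L+1) x / 2^K ≤ x / L`
    intro R hR hRpos x
    have h := hw (3 * R) (by omega) (by omega) x
    set L := 3 * R with hLdef
    have hLpos : 0 < L := by omega
    have hLr : (0 : ℝ) < L := by exact_mod_cast hLpos
    have hRr : (0 : ℝ) < R := by exact_mod_cast hRpos
    have h2K : (W * (L + 1) * L : ℝ) ≤ 2 ^ (W * (L + 1) * L) := by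
      have h1 := (Nat.lt_two_pow_self (n := W * (L + 1) * L)).le
      exact_mod_cast h1
    have hK : (W * (L + 1) : ℝ) * ((x : ℝ) / 2 ^ (W * (L + 1) * L)) ≤ (x : ℝ) / L := by
      rw [mul_div_assoc', div_le_div_iff₀ (by positivity) hLr]
      calc (W * (L + 1) : ℝ) * x * L = (W * (L + 1) * L) * x := by ring
        _ ≤ 2 ^ (W * (L + 1) * L) * x := by gcongr
        _ = x * 2 ^ (W * (L + 1) * L) := by ring
    set mainL := ∑ c ∈ Finset.range (q * Nat.factorial L ^ (W * (L + 1) * L)), w L c *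
        ∑ n ∈ (Finset.Icc 1 x).filter
          (fun n : ℕ => n ≡ c [MOD q * Nat.factorial L ^ (W * (L + 1) * L)]),
          (ArithmeticFunction.liouville ((f.eval (n : ℤ)).toNat) : ℝ) with hmainL
    have habs := abs_sub_abs_le_abs_sub
      (∑ n ∈ (Finset.Icc 1 x).filter (fun n : ℕ => n ≡ a [MOD q]),
          (-1 : ℝ) ^ ArithmeticFunction.cardDistinctFactors ((f.eval (n : ℤ)).toNat)) mainL
    have hle := le_abs_self
      (|mainL| + (2 * N₀ + W * ((L : ℝ) + 1) + 4 * ((Nat.primesLE (Bh * x)).card : ℝ)))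
    have hexp : (W * (L + 1) : ℝ) * ((x : ℝ) / 2 ^ (W * (L + 1) * L) + 1)
        = (W * (L + 1) : ℝ) * ((x : ℝ) / 2 ^ (W * (L + 1) * L)) + W * (L + 1) := by ring
    have h53 : (4 : ℝ) * x / L + x / L ≤ 2 * x / R := by
      have hxR : (0 : ℝ) ≤ x / R := by positivity
      have e1 : (4 : ℝ) * x / L + x / L = 5 / 3 * (x / R) := by
        rw [hLdef]
        push_cast
        field_simp
        ring
      have e2 : (2 : ℝ) * x / R = 2 * (x / R) := by ring
      rw [e1, e2]
      linarith
    linarith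

/-- **Registered stub `stub_liouvilleAP_to_omega`** of line `Sketch` (crux stmt-Parity-11585):
λ-form along every AP ⇒ ω-form along every AP, i.e. the route decl
`Summit.Parity.BatemanHorn.Theses.IsogenyRedei.QuadraticOmegaParity`; alias of
`liouvilleAP_to_quadraticOmegaParity`. [folklore] -/
theorem stub_liouvilleAP_to_omega :
    (∀ f : ℤ[X], Irreducible f → f.natDegree = 2 → 0 < f.leadingCoeff → ∀ q a : ℕ, 0 < q →
      (fun x : ℕ => ∑ n ∈ (Finset.Icc 1 x).filter (fun n : ℕ => n ≡ a [MOD q]),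
        (ArithmeticFunction.liouville ((f.eval (n : ℤ)).toNat) : ℝ)) =o[atTop]
          fun x : ℕ => (x : ℝ)) →
    QuadraticOmegaParity :=
  liouvilleAP_to_quadraticOmegaParity

end Summit.Parity.BatemanHorn.Theorems
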